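import Literature.NumberTheory.Connes2026.SemilocalCutoffConjugation
import Literature.NumberTheory.ConnesConsani2021.SchwartzKernelsHSKernel
import Literature.Analysis.OperatorTheory.L2KernelHilbertSchmidt
import Literature.NumberTheory.Automorphic.AutomorphicL2Separable
import Mathlib.MeasureTheory.Measure.SeparableMeasure
import HarnessLib

/-!
# Connes 1999 Thm VII.4, `k = ℚ`, `S = {∞} ∪ P` — ANNULI AND THE SCALING ACTION:
# shells `Q_{a,b} = P_b − P_a`, support propagation `Q_{a,b} ϑ(h) = Q_{a,b} ϑ(h) Q_{ae^{−r}, be^{r}}`,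
# and the Hilbert–Schmidt kernel of `ϑ(g) Q_{a,b}`

LABEL (line 1): RH-FREE literature (theorems + two definitions with bodies; NO named fact).
bears_on: LADDER-RH W-C/W-P (C1 named-fact debt), cell `rh-crit`, sub-cell cc, overflow row O1 — green layer
under the row's last named fact `Connes1999_thm_VII_4_rat` (the cases `P ≠ ∅`), second file of the
"annulus road" (`SemilocalCutoffConjugation.lean` is the first).  WHAT THIS IS NOT: any claim about
positivity, Weil's criterion or RH — elementary support and kernel bookkeeping for the scaling action on
`L²(ℝ)`; nothing here bears on the truth of RH.

Sources.  A. Connes, Selecta Math. 5 (1999) [`Connes1999`], §VII (12)–(13), Thm VII.4 and its proof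
(29)–(32) (held text `paper:arxiv-math_9811068`, p0013); A. Connes, C. Consani, Selecta Math. 27 (2021) 77
[`ConnesConsani2021`], §4 eq. (40) (`(ϑ(λ)ξ)(v) = λ^{−1/2}ξ(λ⁻¹v)`), §1 Lemma 1.1 (kernels), Prop. 2.2 (iii)
proof p. 10 (`ϑ(f)` as an integral operator; the tree's `scalingKernel`, `scalingOp_coeFn_eq_integral`).

## What is proved

Write `P_Λ = cutoffProj Λ` (Connes 2026 namespace), `Q_{a,b} := P_b − P_a` (`shellProj a b`; for `0 ≤ a ≤ b`
multiplication by `1_{a < |v| ≤ b}`, `shellProj_coeFn`; the top annulus of the first file is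
`annulusProj p Λ = Q_{Λ/p, Λ}`, `annulusProj_eq_shellProj`), `ϑ(e^τ) = scalingUnitary τ`, `ϑ(h) = scalingOp h`.

* §1 Shells: `shellProj_coeFn`, self-adjointness and idempotency (`adjoint_shellProj`, `shellProj_mul_self`),
  and the action of a single dilation: `Q_{a,b} ϑ(e^τ) = ϑ(e^τ) Q_{ae^{−τ}, be^{−τ}}` (`shellProj_mul_scalingUnitary`).
* §2 **Support propagation** (the scaling action moves supports by at most the support radius of the test
  function): if `h(τ) = 0` for `|τ| > r` (`r ≥ 0`) and `0 ≤ a ≤ b`, then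
  `Q_{a,b} ϑ(h) (1 − Q_{ae^{−r}, be^{r}}) = 0` (`shellProj_mul_scalingOp_mul_one_sub_shellProj`), i.e.
  `Q_{a,b} ϑ(h) = Q_{a,b} ϑ(h) Q_{ae^{−r}, be^{r}}` (`shellProj_mul_scalingOp_eq`), and dually
  `(1 − Q_{ae^{−r}, be^{r}}) ϑ(h) Q_{a,b} = 0` (`one_sub_shellProj_mul_scalingOp_mul_shellProj`).
* §3 **The kernel of `ϑ(g) Q_{a,b}`**: for `g ∈ C_c(ℝ)` and `η ∈ L²(ℝ)`,
  `(ϑ(g) Q_{a,b} η)(v) = ∫ k_g(v,y) 1_{a<|y|≤b} η(y) dy` a.e. (`scalingOp_shellProj_coeFn`,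
  `shellScalingKernel`), with the tree's kernel `k_g(v,y) = 1_{vy>0} g(log(v/y))(vy)^{−1/2}` of `ϑ(g)`;
  the kernel is bounded by `M e^{R/2}/a` and supported in `[−be^R, be^R] × [−b, b]` (`‖g‖ ≤ M`,
  `supp g ⊆ [−R, R]`, `0 < a`), hence square integrable (`memLp_shellScalingKernel`), and **`ϑ(g) Q_{a,b}` is
  Hilbert–Schmidt**: `Σ_i ‖ϑ(g) Q_{a,b} e_i‖² = ∫∫ |k_g 1_{shell}|²` along every Hilbert basis of `L²(ℝ)`
  (`hasSum_norm_sq_scalingOp_shellProj`, Reed–Simon VI.23 via the tree's `L2Kernel.hasSum_norm_sq_op`).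

These are analytic steps of the `P ≠ ∅` cases of `Connes1999_thm_VII_4_rat` in the `K_S`-invariant picture:
by the annulus identity of the first file the `p`-adic correction to the cutoff factors through
`Q₀ = Q_{Λ/p,Λ}`, and support propagation localises `ϑ(g)` next to it.  No instance, notation or attribute;
every definition has a body; no `def … : Prop`.
-/

noncomputable section

open _root_.MeasureTheory Complex Set Filter
open scoped Real Topology ComplexConjugate ENNReal InnerProductSpace

namespace Literature.NumberTheory.Connes2026

open Literature.NumberTheory.LFunctions Literature.Analysis.OperatorTheory
open Literature.NumberTheory.ConnesConsani2024
open Literature.NumberTheory.ConnesConsani2021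

/-! ## §1. Shells `Q_{a,b} = P_b − P_a` -/

section Shell

/-- **The shell `Q_{a,b} := P_b − P_a`**: for `0 ≤ a ≤ b`, multiplication by the indicator of
`a < |v| ≤ b` on `L²(ℝ)` — a shell of modules of the `K_S`-invariant picture (Connes 1999 VII (12): `P_Λ`
cuts the module at `Λ`; the proof of Thm VII.4 integrates `dx/|x|` over such shells, eq. (29)).
[cite: Connes1999, §VII eq. (12) and proof of Thm 4 eq. (29) (arXiv p0013)] -/
def shellProj (a b : ℝ) : Lp ℂ 2 (volume : Measure ℝ) →L[ℂ] Lp ℂ 2 (volume : Measure ℝ) :=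
  cutoffProj b - cutoffProj a

/-- Unfolding `shellProj`. [cite: Connes1999, §VII eq. (12) (arXiv p0013)] -/
theorem shellProj_def (a b : ℝ) : shellProj a b = cutoffProj b - cutoffProj a := rfl

/-- The top annulus of `SemilocalCutoffConjugation` is the shell `Q_{Λ/p, Λ}`. [cite: Connes1999, §VII eq. (12) (arXiv p0013)] -/
theorem annulusProj_eq_shellProj (p : ℕ) (Λ : ℝ) : annulusProj p Λ = shellProj (Λ / p) Λ := rfl

/-- The shell set `{v | a < |v| ∧ |v| ≤ b}`. [cite: Connes1999, §VII eq. (12) (arXiv p0013)] -/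
def shellSet (a b : ℝ) : Set ℝ := {v | a < |v| ∧ |v| ≤ b}

/-- Membership in the shell set. [cite: Connes1999, §VII eq. (12) (arXiv p0013)] -/
theorem mem_shellSet_iff {a b v : ℝ} : v ∈ shellSet a b ↔ a < |v| ∧ |v| ≤ b := Iff.rfl

/-- The shell set is measurable. [cite: Connes1999, §VII eq. (12) (arXiv p0013)] -/
theorem measurableSet_shellSet (a b : ℝ) : MeasurableSet (shellSet a b) :=
  (measurableSet_lt measurable_const continuous_abs.measurable).inter
    (measurableSet_le continuous_abs.measurable measurable_const)

/-- For `a ≤ b`: `1_{[−b,b]} − 1_{[−a,a]} = 1_{a<|v|≤b}` pointwise. [folklore] -/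
private theorem indicator_Icc_sub_indicator_Icc {a b : ℝ} (hab : a ≤ b) (f : ℝ → ℂ) (v : ℝ) :
    (Icc (-b) b).indicator f v - (Icc (-a) a).indicator f v = (shellSet a b).indicator f v := by
  by_cases hb : v ∈ Icc (-b) b
  · have hvb : |v| ≤ b := abs_le.mpr ⟨hb.1, hb.2⟩
    by_cases ha : v ∈ Icc (-a) a
    · have hva : |v| ≤ a := abs_le.mpr ⟨ha.1, ha.2⟩
      have hnot : v ∉ shellSet a b := fun h => (not_lt.mpr hva) h.1
      rw [Set.indicator_of_mem hb, Set.indicator_of_mem ha, Set.indicator_of_notMem hnot, sub_self]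
    · have hva : a < |v| := by
        by_contra hle
        exact ha (abs_le.mp (not_lt.mp hle))
      have hmem : v ∈ shellSet a b := ⟨hva, hvb⟩
      rw [Set.indicator_of_mem hb, Set.indicator_of_notMem ha, Set.indicator_of_mem hmem, sub_zero]
  · have hvb : b < |v| := by
      by_contra hle
      exact hb (abs_le.mp (not_lt.mp hle))
    have ha : v ∉ Icc (-a) a := fun h => hb ⟨by linarith [h.1], by linarith [h.2]⟩
    have hnot : v ∉ shellSet a b := fun h => (not_lt.mpr h.2) hvb
    rw [Set.indicator_of_notMem hb, Set.indicator_of_notMem ha, Set.indicator_of_notMem hnot, sub_zero]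

/-- **`Q_{a,b} ξ = 1_{a<|v|≤b} ξ` almost everywhere** (`a ≤ b`). [cite: Connes1999, §VII eq. (12) (arXiv p0013)] -/
theorem shellProj_coeFn {a b : ℝ} (hab : a ≤ b) (ξ : Lp ℂ 2 (volume : Measure ℝ)) :
    (shellProj a b ξ : ℝ → ℂ) =ᵐ[volume] (shellSet a b).indicator (ξ : ℝ → ℂ) := by
  rw [shellProj_def, sub_apply]
  filter_upwards [Lp.coeFn_sub (cutoffProj b ξ) (cutoffProj a ξ), cutoffProj_coeFn b ξ, cutoffProj_coeFn a ξ]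
    with v h1 h2 h3
  rw [h1, Pi.sub_apply, h2, h3, indicator_Icc_sub_indicator_Icc hab]

/-- `Q_{a,b}` is self-adjoint. [cite: Connes1999, §VII eq. (12) (arXiv p0013)] -/
theorem adjoint_shellProj (a b : ℝ) : ContinuousLinearMap.adjoint (shellProj a b) = shellProj a b := by
  rw [shellProj_def, map_sub, adjoint_cutoffProj, adjoint_cutoffProj]

/-- `P_c Q_{a,b}`-type products: `P_c P_d = P_{min}` in the form `P_a P_b = P_a` for `a ≤ b`. [cite: Connes1999, §VII eq. (12) (arXiv p0013)] -/
theorem cutoffProj_mul_cutoffProj_of_le {a b : ℝ} (hab : a ≤ b) : cutoffProj a * cutoffProj b = cutoffProj a := by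
  ext ξ : 1
  change cutoffProj a (cutoffProj b ξ) = cutoffProj a ξ
  apply Lp.ext
  filter_upwards [cutoffProj_coeFn a (cutoffProj b ξ), cutoffProj_coeFn b ξ, cutoffProj_coeFn a ξ] with v h1 h2 h3
  rw [h1, h3]
  by_cases ha : v ∈ Icc (-a) a
  · have hb : v ∈ Icc (-b) b := ⟨by linarith [ha.1], by linarith [ha.2]⟩
    rw [Set.indicator_of_mem ha, Set.indicator_of_mem ha, h2, Set.indicator_of_mem hb]
  · rw [Set.indicator_of_notMem ha, Set.indicator_of_notMem ha]

/-- `P_b P_a = P_a` for `a ≤ b`. [cite: Connes1999, §VII eq. (12) (arXiv p0013)] -/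
theorem cutoffProj_mul_cutoffProj_of_ge {a b : ℝ} (hab : a ≤ b) : cutoffProj b * cutoffProj a = cutoffProj a := by
  have h := congrArg ContinuousLinearMap.adjoint (cutoffProj_mul_cutoffProj_of_le hab)
  rw [← ContinuousLinearMap.star_eq_adjoint, ← ContinuousLinearMap.star_eq_adjoint, star_mul,
    ContinuousLinearMap.star_eq_adjoint, ContinuousLinearMap.star_eq_adjoint, adjoint_cutoffProj,
    adjoint_cutoffProj] at h
  exact h

/-- `Q_{a,b}` is idempotent (`a ≤ b`). [cite: Connes1999, §VII eq. (12) (arXiv p0013)] -/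
theorem shellProj_mul_self {a b : ℝ} (hab : a ≤ b) : shellProj a b * shellProj a b = shellProj a b := by
  rw [shellProj_def, mul_sub, sub_mul, sub_mul, cutoffProj_mul_self, cutoffProj_mul_cutoffProj_of_le hab,
    cutoffProj_mul_cutoffProj_of_ge hab, cutoffProj_mul_self, sub_self, sub_zero]

/-- **A dilation moves a shell**: `Q_{a,b} ϑ(e^τ) = ϑ(e^τ) Q_{ae^{−τ}, be^{−τ}}`. [cite: Connes1999, §VII proof of Thm 4 eq. (29) (arXiv p0013)] -/
theorem shellProj_mul_scalingUnitary (a b τ : ℝ) :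
    shellProj a b * scalingUnitary τ = scalingUnitary τ * shellProj (a * Real.exp (-τ)) (b * Real.exp (-τ)) := by
  rw [shellProj_def, shellProj_def, sub_mul, mul_sub, cutoffProj_mul_scalingUnitary, cutoffProj_mul_scalingUnitary]

end Shell

/-! ## §2. Support propagation: `Q_{a,b} ϑ(h) = Q_{a,b} ϑ(h) Q_{ae^{−r}, be^{r}}` -/

section Support

variable {h : ℝ → ℂ} {r : ℝ}

/-- For `|τ| ≤ r`, `0 ≤ a` and `v` in the shell `a < |v| ≤ b`, the point `e^{−τ}v` lies in the fattened shell
`ae^{−r} < |e^{−τ}v| ≤ be^{r}`. [folklore] -/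
private theorem exp_neg_mul_mem_shellSet {a b v τ : ℝ} (ha : 0 ≤ a) (hτ : |τ| ≤ r) (hv : v ∈ shellSet a b) :
    Real.exp (-τ) * v ∈ shellSet (a * Real.exp (-r)) (b * Real.exp r) := by
  obtain ⟨hav, hvb⟩ := hv
  have hb : 0 ≤ b := le_trans (abs_nonneg v) hvb
  have hτ1 : -r ≤ τ := (abs_le.mp hτ).1
  have hτ2 : τ ≤ r := (abs_le.mp hτ).2
  have he : 0 < Real.exp (-τ) := Real.exp_pos _
  rw [mem_shellSet_iff, abs_mul, abs_of_pos he]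
  constructor
  · calc a * Real.exp (-r) ≤ a * Real.exp (-τ) :=
          mul_le_mul_of_nonneg_left (Real.exp_le_exp.mpr (by linarith)) ha
      _ = Real.exp (-τ) * a := mul_comm _ _
      _ < Real.exp (-τ) * |v| := mul_lt_mul_of_pos_left hav he
  · calc Real.exp (-τ) * |v| ≤ Real.exp (-τ) * b := mul_le_mul_of_nonneg_left hvb he.le
      _ ≤ Real.exp r * b := mul_le_mul_of_nonneg_right (Real.exp_le_exp.mpr (by linarith)) hb
      _ = b * Real.exp r := mul_comm _ _

/-- For `|τ| ≤ r`: `Q_{a,b} ϑ(e^τ) (1 − Q_{ae^{−r}, be^{r}}) = 0` — a single dilation by at most `e^{±r}` cannot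
move a vector supported off the fattened shell into the shell. [cite: Connes1999, §VII proof of Thm 4 eqs. (29)–(32) (arXiv p0013)] -/
theorem shellProj_scalingUnitary_one_sub_shellProj {a b τ : ℝ} (ha : 0 ≤ a) (hab : a ≤ b) (hr : |τ| ≤ r)
    (ξ : Lp ℂ 2 (volume : Measure ℝ)) :
    shellProj a b (scalingUnitary τ ((1 - shellProj (a * Real.exp (-r)) (b * Real.exp r)) ξ)) = 0 := by
  have hr0 : 0 ≤ r := le_trans (abs_nonneg τ) hr
  have hab' : a * Real.exp (-r) ≤ b * Real.exp r :=
    le_trans (mul_le_mul_of_nonneg_left (Real.exp_le_exp.mpr (by linarith)) ha)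
      (mul_le_mul_of_nonneg_right hab (Real.exp_pos r).le)
  set ζ := (1 - shellProj (a * Real.exp (-r)) (b * Real.exp r)) ξ with hζ
  have hζae : (ζ : ℝ → ℂ) =ᵐ[volume]
      fun w => (ξ : ℝ → ℂ) w - (shellSet (a * Real.exp (-r)) (b * Real.exp r)).indicator (ξ : ℝ → ℂ) w := by
    rw [hζ, sub_apply, one_apply_eq_self]
    filter_upwards [Lp.coeFn_sub ξ (shellProj (a * Real.exp (-r)) (b * Real.exp r) ξ),
      shellProj_coeFn hab' ξ] with w h1 h2
    rw [h1, Pi.sub_apply, h2]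
  apply Lp.ext
  filter_upwards [shellProj_coeFn hab (scalingUnitary τ ζ), scalingUnitary_coeFn τ ζ,
    ae_eq_comp_smul (V := ℝ) hζae (Real.exp_pos (-τ)).ne',
    Lp.coeFn_zero (E := ℂ) (p := (2 : ℝ≥0∞)) (μ := (volume : Measure ℝ))] with v h1 h2 h3 h4
  rw [h1, h4, Pi.zero_apply]
  by_cases hv : v ∈ shellSet a b
  · rw [Set.indicator_of_mem hv, h2]
    simp only [smul_eq_mul] at h3
    rw [h3, Set.indicator_of_mem (exp_neg_mul_mem_shellSet ha hr hv), sub_self, mul_zero]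
  · rw [Set.indicator_of_notMem hv]

/-- **Support propagation**: if `h(τ) = 0` for `|τ| > r` and `0 ≤ a ≤ b`, then
`Q_{a,b} ϑ(h) (1 − Q_{ae^{−r}, be^{r}}) = 0` — `ϑ(h) = ∫ h(τ)ϑ(e^τ)dτ` only involves dilations by at most
`e^{±r}`. [cite: Connes1999, §VII proof of Thm 4 eqs. (29)–(32) (arXiv p0013); ConnesConsani2021, Prop. 2.2 (iii) p. 10 (proof: `ϑ(f) = ∫ f(λ)ϑ(λ)d^*λ`)] -/
theorem shellProj_mul_scalingOp_mul_one_sub_shellProj {a b : ℝ} (ha : 0 ≤ a) (hab : a ≤ b)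
    (hsupp : ∀ τ, r < |τ| → h τ = 0) :
    shellProj a b * scalingOp h * (1 - shellProj (a * Real.exp (-r)) (b * Real.exp r)) = 0 := by
  by_cases hint : Integrable h
  · ext ξ : 1
    change shellProj a b (scalingOp h ((1 - shellProj (a * Real.exp (-r)) (b * Real.exp r)) ξ)) = 0
    set ζ := (1 - shellProj (a * Real.exp (-r)) (b * Real.exp r)) ξ with hζ
    rw [scalingOp_apply hint, ← ContinuousLinearMap.integral_comp_comm _ (integrable_smul_scalingUnitary hint ζ)]
    have hzero : (fun τ => shellProj a b (h τ • scalingUnitary τ ζ)) = fun _ => 0 := by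
      funext τ
      rw [ContinuousLinearMap.map_smul]
      by_cases hτ : r < |τ|
      · rw [hsupp τ hτ, zero_smul]
      · rw [hζ, shellProj_scalingUnitary_one_sub_shellProj ha hab (not_lt.mp hτ) ξ, smul_zero]
    rw [hzero, integral_zero]
  · have h0 : scalingOp h = 0 := by
      unfold scalingOp
      rw [dif_neg hint]
    rw [h0, mul_zero, zero_mul]

/-- Support propagation, product form: `Q_{a,b} ϑ(h) = Q_{a,b} ϑ(h) Q_{ae^{−r}, be^{r}}`. [cite: Connes1999, §VII proof of Thm 4 eqs. (29)–(32) (arXiv p0013)] -/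
theorem shellProj_mul_scalingOp_eq {a b : ℝ} (ha : 0 ≤ a) (hab : a ≤ b) (hsupp : ∀ τ, r < |τ| → h τ = 0) :
    shellProj a b * scalingOp h =
      shellProj a b * scalingOp h * shellProj (a * Real.exp (-r)) (b * Real.exp r) := by
  have h0 := shellProj_mul_scalingOp_mul_one_sub_shellProj ha hab hsupp
  rw [mul_sub, mul_one, sub_eq_zero] at h0
  exact h0

/-- The reflected test function `τ ↦ conj h(−τ)` vanishes where `h` does (same support radius). [folklore] -/
private theorem weilReflect_eq_zero_of (hsupp : ∀ τ, r < |τ| → h τ = 0) (τ : ℝ) (hτ : r < |τ|) :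
    weilReflect h τ = 0 := by
  rw [weilReflect, hsupp (-τ) (by rwa [abs_neg]), map_zero]

/-- **Support propagation, dual form**: `(1 − Q_{ae^{−r}, be^{r}}) ϑ(h) Q_{a,b} = 0` (adjoint of the previous
statement for the reflected test function `h̃(τ) = conj h(−τ)`, `ϑ(h)^* = ϑ(h̃)`). [cite: Connes1999, §VII proof of Thm 4 eqs. (29)–(32) (arXiv p0013); ConnesConsani2021, Prop. 2.2 (iii) p. 10] -/
theorem one_sub_shellProj_mul_scalingOp_mul_shellProj {a b : ℝ} (ha : 0 ≤ a) (hab : a ≤ b)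
    (hint : Integrable h) (hsupp : ∀ τ, r < |τ| → h τ = 0) :
    (1 - shellProj (a * Real.exp (-r)) (b * Real.exp r)) * scalingOp h * shellProj a b = 0 := by
  have hint' : Integrable (weilReflect h) := by
    have := (Complex.conjLIE.toContinuousLinearMap.integrable_comp (hint.comp_neg))
    refine this.congr (Eventually.of_forall fun τ => ?_)
    simp [weilReflect]
  have h0 := shellProj_mul_scalingOp_mul_one_sub_shellProj ha hab (weilReflect_eq_zero_of hsupp) (h := weilReflect h)
  have h1 := congrArg ContinuousLinearMap.adjoint h0
  rw [← ContinuousLinearMap.star_eq_adjoint, ← ContinuousLinearMap.star_eq_adjoint, star_mul, star_mul, star_sub,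
    star_one, star_zero, ContinuousLinearMap.star_eq_adjoint, ContinuousLinearMap.star_eq_adjoint,
    ContinuousLinearMap.star_eq_adjoint, adjoint_shellProj, adjoint_shellProj, adjoint_scalingOp hint'] at h1
  have h2 : weilReflect (weilReflect h) = h := by
    funext τ; simp [weilReflect]
  rw [h2, ← mul_assoc] at h1
  exact h1

end Support

/-! ## §3. The kernel of `ϑ(g) Q_{a,b}` -/

section Kernel

variable {g : ℝ → ℂ}

/-- **The kernel of `ϑ(g) Q_{a,b}`**: `k_g(v,y) 1_{a<|y|≤b}` with the tree's kernel `k_g` of `ϑ(g)`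
(`scalingKernel`, `k_g(v,y) = 1_{vy>0} g(log(v/y)) (vy)^{−1/2}`). [cite: ConnesConsani2021, §4 eq. (40) p. 15; §1 Lemma 1.1 p. 7; Prop. 2.2 (iii) proof p. 10] -/
def shellScalingKernel (g : ℝ → ℂ) (a b : ℝ) (v y : ℝ) : ℂ :=
  (shellSet a b).indicator (fun y => scalingKernel g v y) y

/-- Unfolding `shellScalingKernel` as a product with the indicator of the shell. [cite: ConnesConsani2021, §4 eq. (40) p. 15] -/
theorem shellScalingKernel_eq (g : ℝ → ℂ) (a b v y : ℝ) :
    shellScalingKernel g a b v y = scalingKernel g v y * (shellSet a b).indicator (fun _ => (1 : ℂ)) y := by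
  unfold shellScalingKernel
  by_cases hy : y ∈ shellSet a b
  · rw [Set.indicator_of_mem hy, Set.indicator_of_mem hy, mul_one]
  · rw [Set.indicator_of_notMem hy, Set.indicator_of_notMem hy, mul_zero]

/-- **`ϑ(g) Q_{a,b}` is the integral operator with kernel `k_g(v,y) 1_{a<|y|≤b}`** (a.e. on `L²(ℝ)`), for
`g ∈ C_c(ℝ)`, `0 ≤ a ≤ b`... (only `a ≤ b` is used). [cite: ConnesConsani2021, §4 eq. (40) p. 15; §1 Lemma 1.1 p. 7; Prop. 2.2 (iii) proof p. 10] -/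
theorem scalingOp_shellProj_coeFn (hg : Continuous g) (hgs : HasCompactSupport g) {a b : ℝ} (hab : a ≤ b)
    (η : Lp ℂ 2 (volume : Measure ℝ)) :
    (scalingOp g (shellProj a b η) : ℝ → ℂ) =ᵐ[volume]
      fun v => ∫ y, shellScalingKernel g a b v y * (η : ℝ → ℂ) y := by
  have h1 := scalingOp_coeFn_eq_integral hg hgs (shellProj a b η)
  have h2 := shellProj_coeFn hab η
  refine h1.trans (Eventually.of_forall fun v => ?_)
  refine integral_congr_ae ?_
  filter_upwards [h2] with y hy
  rw [hy, shellScalingKernel]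
  by_cases hys : y ∈ shellSet a b
  · rw [Set.indicator_of_mem hys, Set.indicator_of_mem hys]
  · rw [Set.indicator_of_notMem hys, Set.indicator_of_notMem hys, mul_zero, zero_mul]

/-- Measurability of the tree's kernel `k_g` of `ϑ(g)` (jointly in `(v, y)`). [cite: ConnesConsani2021, §4 eq. (40) p. 15] -/
theorem measurable_uncurry_scalingKernel (hg : Measurable g) : Measurable (Function.uncurry (scalingKernel g)) := by
  have h1 : Measurable fun z : ℝ × ℝ => g (Real.log (z.1 / z.2)) * (((Real.sqrt (z.1 * z.2))⁻¹ : ℝ) : ℂ) :=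
    (hg.comp (Real.measurable_log.comp (measurable_fst.div measurable_snd))).mul
      (Complex.measurable_ofReal.comp ((Real.continuous_sqrt.measurable.comp
        (measurable_fst.mul measurable_snd)).inv))
  have h2 : MeasurableSet {z : ℝ × ℝ | 0 < z.1 * z.2} :=
    measurableSet_lt measurable_const (measurable_fst.mul measurable_snd)
  have h3 : Function.uncurry (scalingKernel g) =
      fun z : ℝ × ℝ => if 0 < z.1 * z.2 then g (Real.log (z.1 / z.2)) * (((Real.sqrt (z.1 * z.2))⁻¹ : ℝ) : ℂ)
        else 0 := by
    funext z
    rcases z with ⟨v, y⟩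
    simp only [Function.uncurry_apply_pair, scalingKernel]
  rw [h3]
  exact Measurable.ite h2 h1 measurable_const

/-- Measurability of the kernel of `ϑ(g) Q_{a,b}`. [cite: ConnesConsani2021, §4 eq. (40) p. 15] -/
theorem measurable_uncurry_shellScalingKernel (hg : Measurable g) (a b : ℝ) :
    Measurable (Function.uncurry (shellScalingKernel g a b)) := by
  have h1 := measurable_uncurry_scalingKernel hg
  have h2 : Measurable fun z : ℝ × ℝ => (shellSet a b).indicator (fun _ => (1 : ℂ)) z.2 :=
    (measurable_const.indicator (measurableSet_shellSet a b)).comp measurable_snd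
  have h3 : Function.uncurry (shellScalingKernel g a b) =
      fun z : ℝ × ℝ => Function.uncurry (scalingKernel g) z * (shellSet a b).indicator (fun _ => (1 : ℂ)) z.2 := by
    funext z
    rcases z with ⟨v, y⟩
    simp only [Function.uncurry_apply_pair, shellScalingKernel_eq]
  rw [h3]
  exact h1.mul h2

/-- **Support of the kernel of `ϑ(g) Q_{a,b}`**: if `g(τ) = 0` for `|τ| > R` and `0 < a ≤ b`, the kernel
`k_g(v,y)1_{a<|y|≤b}` vanishes unless `|y| ≤ b` and `|v| ≤ b e^{R}` (the scaling action moves the shell by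
at most `e^{R}`). [cite: ConnesConsani2021, §4 eq. (40) p. 15; Prop. 2.2 (iii) proof p. 10] -/
theorem shellScalingKernel_eq_zero_of_not_mem {R a b : ℝ} (ha : 0 < a) (hsupp : ∀ τ, R < |τ| → g τ = 0)
    {v y : ℝ} (hvy : (v, y) ∉ Icc (-(b * Real.exp R)) (b * Real.exp R) ×ˢ Icc (-b) b) :
    shellScalingKernel g a b v y = 0 := by
  rw [shellScalingKernel]
  by_cases hy : y ∈ shellSet a b
  · rw [Set.indicator_of_mem hy]
    have hyb : y ∈ Icc (-b) b := by
      have := hy.2; constructor <;> linarith [abs_le.mp this |>.1, abs_le.mp this |>.2]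
    have hv : v ∉ Icc (-(b * Real.exp R)) (b * Real.exp R) := fun h => hvy ⟨h, hyb⟩
    by_cases hpos : 0 < v * y
    · rw [scalingKernel_of_pos hpos]
      have hy0 : 0 < |y| := lt_trans ha hy.1
      have hvy0 : 0 < |v| / |y| := by
        rw [← abs_div]; exact abs_pos.mpr (div_ne_zero (fun h => by simp [h] at hpos) (abs_pos.mp hy0))
      -- `|v| > b e^R ≥ |y| e^R`, so `log(v/y) = log(|v|/|y|) > R`
      have hvgt : b * Real.exp R < |v| := by
        by_contra hle
        exact hv (abs_le.mp (not_lt.mp hle))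
      have hratio : Real.exp R < |v| / |y| := by
        rw [lt_div_iff₀ hy0]
        calc Real.exp R * |y| ≤ Real.exp R * b := mul_le_mul_of_nonneg_left hy.2 (Real.exp_pos R).le
          _ = b * Real.exp R := mul_comm _ _
          _ < |v| := hvgt
      have hlog : R < Real.log (v / y) := by
        have hq : v / y = |v| / |y| := by
          rw [← abs_div]; exact (abs_of_pos (by
            rcases lt_trichotomy y 0 with h | h | h
            · exact div_pos_of_neg_of_neg (by nlinarith) h
            · simp [h] at hpos
            · exact div_pos (by nlinarith) h)).symm
        rw [hq, ← Real.exp_lt_exp, Real.exp_log hvy0]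
        exact hratio
      rw [hsupp _ (lt_of_lt_of_le hlog (le_abs_self _)), zero_mul]
    · rw [scalingKernel_of_not_pos hpos]
  · rw [Set.indicator_of_notMem hy]

/-- **Bound for the kernel of `ϑ(g) Q_{a,b}`**: if `‖g‖ ≤ M` and `g(τ) = 0` for `|τ| > R`, `0 < a ≤ b`, then
`‖k_g(v,y)1_{a<|y|≤b}‖ ≤ M e^{R/2}/a` (on the support `vy = |v||y| > a² e^{−R}`). [cite: ConnesConsani2021, §4 eq. (40) p. 15; Prop. 2.2 (iii) proof p. 10] -/
theorem norm_shellScalingKernel_le {M R a b : ℝ} (hM : ∀ t, ‖g t‖ ≤ M) (hsupp : ∀ τ, R < |τ| → g τ = 0)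
    (ha : 0 < a) (v y : ℝ) :
    ‖shellScalingKernel g a b v y‖ ≤ M * (Real.exp (R / 2) / a) := by
  have hM0 : 0 ≤ M := le_trans (norm_nonneg _) (hM 0)
  have hbound0 : 0 ≤ M * (Real.exp (R / 2) / a) := mul_nonneg hM0 (div_nonneg (Real.exp_pos _).le ha.le)
  rw [shellScalingKernel]
  by_cases hy : y ∈ shellSet a b
  · rw [Set.indicator_of_mem hy]
    by_cases hpos : 0 < v * y
    · rw [scalingKernel_of_pos hpos, norm_mul, Complex.norm_real, Real.norm_eq_abs,
        abs_of_nonneg (inv_nonneg.mpr (Real.sqrt_nonneg _))]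
      by_cases hg0 : g (Real.log (v / y)) = 0
      · rw [hg0, norm_zero, zero_mul]; exact hbound0
      · -- on the support: `|log(v/y)| ≤ R`, so `|v| ≥ |y| e^{-R} > a e^{-R}` and `vy ≥ a² e^{-R}`
        have hlogle : |Real.log (v / y)| ≤ R := not_lt.mp fun h => hg0 (hsupp _ h)
        have hy0 : 0 < |y| := lt_trans ha hy.1
        have hvyabs : v * y = |v| * |y| := by rw [← abs_mul, abs_of_pos hpos]
        have hv0 : 0 < |v| := abs_pos.mpr fun h => by simp [h] at hpos
        have hq : v / y = |v| / |y| := by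
          have : 0 < v / y := by
            rcases lt_trichotomy y 0 with h | h | h
            · exact div_pos_of_neg_of_neg (by nlinarith) h
            · simp [h] at hpos
            · exact div_pos (by nlinarith) h
          rw [← abs_div, abs_of_pos this]
        have hratio : Real.exp (-R) ≤ |v| / |y| := by
          have h1 : -R ≤ Real.log (|v| / |y|) := by rw [← hq]; exact (abs_le.mp hlogle).1
          calc Real.exp (-R) ≤ Real.exp (Real.log (|v| / |y|)) := Real.exp_le_exp.mpr h1
            _ = |v| / |y| := Real.exp_log (div_pos hv0 hy0)
        have hvge : |y| * Real.exp (-R) ≤ |v| := by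
          rw [le_div_iff₀ hy0] at hratio; linarith [hratio]
        have hprod : a * a * Real.exp (-R) ≤ v * y := by
          rw [hvyabs]
          calc a * a * Real.exp (-R) ≤ |y| * |y| * Real.exp (-R) := by
                have := hy.1.le
                exact mul_le_mul_of_nonneg_right (mul_le_mul this this ha.le (abs_nonneg _)) (Real.exp_pos _).le
            _ = (|y| * Real.exp (-R)) * |y| := by ring
            _ ≤ |v| * |y| := mul_le_mul_of_nonneg_right hvge (abs_nonneg _)
        have hsqrt : a * Real.exp (-(R / 2)) ≤ Real.sqrt (v * y) := by
          rw [show a * Real.exp (-(R / 2)) = Real.sqrt (a * a * Real.exp (-R)) by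
            rw [show a * a * Real.exp (-R) = (a * Real.exp (-(R / 2))) ^ 2 by
              rw [mul_pow, ← Real.exp_nat_mul]; ring_nf]
            rw [Real.sqrt_sq (mul_nonneg ha.le (Real.exp_pos _).le)]]
          exact Real.sqrt_le_sqrt hprod
        have hpos' : 0 < a * Real.exp (-(R / 2)) := mul_pos ha (Real.exp_pos _)
        have hinv : (Real.sqrt (v * y))⁻¹ ≤ Real.exp (R / 2) / a := by
          rw [show Real.exp (R / 2) / a = (a * Real.exp (-(R / 2)))⁻¹ by
            rw [mul_inv, Real.exp_neg, inv_inv, div_eq_mul_inv, mul_comm]]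
          exact inv_anti₀ hpos' hsqrt
        exact mul_le_mul (hM _) hinv (inv_nonneg.mpr (Real.sqrt_nonneg _)) hM0
    · rw [scalingKernel_of_not_pos hpos, norm_zero]; exact hbound0
  · rw [Set.indicator_of_notMem hy, norm_zero]; exact hbound0

/-- **The kernel of `ϑ(g) Q_{a,b}` is square integrable on `ℝ × ℝ`** (`g ∈ C_c(ℝ)`, `0 < a ≤ b`): it is
bounded and supported in the box `[−be^R, be^R] × [−b, b]`.  Hence `ϑ(g) Q_{a,b}` is a Hilbert–Schmidt
operator (Reed–Simon VI.23), although `ϑ(g)` itself is not (its kernel is homogeneous of degree `−1`).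
[cite: ConnesConsani2021, §4 eq. (40) p. 15, §1 Lemma 1.1 p. 7; ReedSimon1972, Thm. VI.23, PDF pp. 198–199] -/
theorem memLp_shellScalingKernel (hg : Continuous g) (hgs : HasCompactSupport g) {a b : ℝ} (ha : 0 < a) :
    MemLp (Function.uncurry (shellScalingKernel g a b)) 2 ((volume : Measure ℝ).prod (volume : Measure ℝ)) := by
  -- a bound and a support radius for `g`
  obtain ⟨M, hM⟩ := hg.bounded_above_of_compact_support hgs
  obtain ⟨R, hR⟩ := hgs.isCompact.isBounded.subset_closedBall 0
  have hsupp : ∀ τ, R < |τ| → g τ = 0 := by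
    intro τ hτ
    by_contra hne
    have hmem : τ ∈ Metric.closedBall (0 : ℝ) R := hR (subset_tsupport g hne)
    rw [Metric.mem_closedBall, dist_zero_right, Real.norm_eq_abs] at hmem
    exact (not_lt.mpr hmem) hτ
  have hmeas : AEStronglyMeasurable (Function.uncurry (shellScalingKernel g a b))
      ((volume : Measure ℝ).prod (volume : Measure ℝ)) :=
    (measurable_uncurry_shellScalingKernel hg.measurable a b).aestronglyMeasurable
  rw [memLp_two_iff_integrable_sq_norm hmeas]
  -- domination by a constant on a box of finite measure
  set S : Set (ℝ × ℝ) := Icc (-(b * Real.exp R)) (b * Real.exp R) ×ˢ Icc (-b) b with hS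
  have hSmeas : MeasurableSet S := measurableSet_Icc.prod measurableSet_Icc
  have hSfin : ((volume : Measure ℝ).prod (volume : Measure ℝ)) S < ∞ := by
    rw [hS, Measure.prod_prod]
    exact ENNReal.mul_lt_top measure_Icc_lt_top measure_Icc_lt_top
  set C : ℝ := (M * (Real.exp (R / 2) / a)) ^ 2 with hC
  have hdom : Integrable (S.indicator fun _ : ℝ × ℝ => C) ((volume : Measure ℝ).prod (volume : Measure ℝ)) :=
    (integrableOn_const (μ := (volume : Measure ℝ).prod (volume : Measure ℝ)) (s := S) (C := C) hSfin.ne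
      (by simp)).integrable_indicator hSmeas
  refine Integrable.mono' hdom ((hmeas.norm.pow 2)) (Eventually.of_forall fun z => ?_)
  rcases z with ⟨v, y⟩
  rw [Real.norm_eq_abs, abs_of_nonneg (sq_nonneg _), Function.uncurry_apply_pair]
  by_cases hz : (v, y) ∈ S
  · rw [Set.indicator_of_mem hz, hC]
    exact pow_le_pow_left₀ (norm_nonneg _) (norm_shellScalingKernel_le hM hsupp ha v y) 2
  · rw [Set.indicator_of_notMem hz, shellScalingKernel_eq_zero_of_not_mem ha hsupp hz, norm_zero,
      zero_pow two_ne_zero]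

/-- A Hilbert basis of `L²(ℝ)` has a countable index (`L²(ℝ)` is separable). [cite: ReedSimon1972, Thm. II.7] -/
theorem countable_of_hilbertBasis_L2 {ι : Type*} (e : HilbertBasis ι ℂ (Lp ℂ 2 (volume : Measure ℝ))) :
    Countable ι := by
  haveI : Fact ((2 : ℝ≥0∞) ≠ ∞) := ⟨ENNReal.ofNat_ne_top⟩
  exact HilbertBasis.countable_index_of_separableSpace e

/-- **`ϑ(g) Q_{a,b}` is Hilbert–Schmidt**: along every Hilbert basis `(e_i)` of `L²(ℝ)`,
`Σ_i ‖ϑ(g) Q_{a,b} e_i‖² = ∫∫ |k_g(v,y)|² 1_{a<|y|≤b} dy dv < ∞` (`g ∈ C_c(ℝ)`, `0 < a ≤ b`; Reed–Simon VI.23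
for the square-integrable kernel of `scalingOp_shellProj_coeFn`).  This is what makes the annulus-localised
pieces of `ϑ(g) R_Λ^S` trace class although `R_Λ^S` itself is not Hilbert–Schmidt for `S ≠ {∞}`.
[cite: ConnesConsani2021, §4 eq. (40) p. 15, Prop. 2.2 (iii) proof p. 10; ReedSimon1972, Thm. VI.23, PDF pp. 198–199] -/
theorem hasSum_norm_sq_scalingOp_shellProj (hg : Continuous g) (hgs : HasCompactSupport g) {a b : ℝ}
    (ha : 0 < a) (hab : a ≤ b) {ι : Type*} (e : HilbertBasis ι ℂ (Lp ℂ 2 (volume : Measure ℝ))) :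
    HasSum (fun i => ‖scalingOp g (shellProj a b (e i))‖ ^ 2)
      (∫ v, ∫ y, ‖shellScalingKernel g a b v y‖ ^ 2) := by
  haveI : Countable ι := countable_of_hilbertBasis_L2 e
  have h := L2Kernel.hasSum_norm_sq_op (μ := (volume : Measure ℝ)) (ν := (volume : Measure ℝ))
    (memLp_shellScalingKernel hg hgs ha (b := b)) (A := scalingOp g ∘L shellProj a b)
    (fun φ => by simpa only [ContinuousLinearMap.comp_apply] using scalingOp_shellProj_coeFn hg hgs hab φ) e
  simpa only [ContinuousLinearMap.comp_apply] using h

end Kernel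

end Literature.NumberTheory.Connes2026
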